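import Literature.MathematicalPhysics.QuantumFieldTheory.Balaban1983to89.Beta.TreeSliceUnipotent

/-!
# `Balaban1983to89.Beta.OrbitPolarization` — the ORBIT POLARIZATION of a sliced constrained Gaussian family: a NAME for RULING (R29-2)'s
# «Hess₀ log Z_orbit» at MODEL level, its SLICE-INDEPENDENCE, its reading on forest (unipotent) slices, and (v1.1) TREE-INDEPENDENCE

HONEST FRAMING (cell `pub-balaban`, β-function road; verbatim): «discharging BetaPertH makes Balaban's UV stability UNCONDITIONAL —
a real constructive-QFT result; it is NOT the continuum limit and NOT the Clay problem.»  ABSOLUTE RULE (verbatim): «No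
internally-minted statement may enter as a cited fact. Every hypothesis is either kernel-proved in this package or a verbatim
quotation of a PUBLISHED theorem with page reference. The manuscript(s) under audit are NOT citable for their own disputed steps —
they are the thing under adjudication; programme-internal (2001/route/tribunal) claims are never citable.»  This file cites NOTHING
and asserts nothing of the series: every declaration is [folklore] finite-dimensional algebra/calculus over pv25's `Beta.GaugeFixing`
(v1.1, §5 the slice-change DEFECT) and the co-lead's `Beta.TreeSliceUnipotent` (v1–v1.2), BY NAME.  No `def … : Prop`, 0 sorry.

WHAT (lead strat-b12 gen 12, seam pin of RULING (R29), journal 2026-08-19 16:05Z; SLICE-FP-NOTE.md v0.5 §2/§7.1).  For a `B`-family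
`F` of constrained Gaussian data read in a `B`-dependent SHARP slice `τ B` with linearised orbit directions `W B`, the τ-polarization
`polarization (withSlice F τ)` (= Hess₀ of `log Z_τ`) depends on the slice through the Faddeev–Popov logarithm `log|det(τ B · W B)|`
(`GaugeFixing.polarization_withSlice_eq_sub_add`, II′).  The combination

  `orbitPol F τ W i j := polarization (withSlice F τ) i j + hessianAt (log|det(τ·W)|) i j`

is therefore SLICE-INDEPENDENT under II′'s hypotheses (`orbitPol_eq_of_slices`) — it is the Hessian at `0` of «log Z_orbit»
(log-Z sign; the effective-action / `hessKer` sign of the cell's `TbalOf` is MINUS this).  On a FOREST slice (tree bond of every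
non-root vertex ends at it; parents of lower rank; unimodular child-end transports — `TreeSliceUnipotent`) the FP term vanishes and
`orbitPol = polarization` (`orbitPol_eq_polarization_of_forest`); in a general slice `polarization = orbitPol − hessianAt log|det τW|`
(`polarization_eq_orbitPol_sub` — the MODEL form of (R29-1) «typed kernel = orbit kernel − ghost loop», log-Z sign).  Which concrete
`τ`, `W`, forest data realise the cell's typed slices / Bałaban's (0.14)–(0.16) is for the rows that build the families ((T-def)
dictionary, IDENT-122-CHECKLIST (D-e)/(D-h)); nothing here discharges a wall binder.  NOT summit progress; NOT continuum; NOT Clay.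
-/

noncomputable section

namespace Literature.MathematicalPhysics.QuantumFieldTheory.Balaban1983to89.Beta.OrbitPolarization

open Matrix
open Literature.MathematicalPhysics.QuantumFieldTheory.Balaban1983to89.Beta
open Literature.MathematicalPhysics.QuantumFieldTheory.Balaban1983to89.Beta.GaugeFixing
open Literature.MathematicalPhysics.QuantumFieldTheory.Balaban1983to89.Beta.TreeSliceUnipotent

variable {ι : Type*} [Fintype ι] [DecidableEq ι] {n m r : ℕ}

/-- [folklore] **THE ORBIT POLARIZATION** of the family `F` READ IN the slice `τ` with orbit directions `W`: the τ-polarization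
plus the Hessian at `0` of τ's Faddeev–Popov logarithm `B ↦ log|det(τ B · W B)|` (log-Z sign). -/
def orbitPol (F : Family ι n m) (τ : (ι → ℝ) → Matrix (Fin r) (Fin n) ℝ) (W : (ι → ℝ) → Matrix (Fin n) (Fin r) ℝ)
    (i j : ι) : ℝ :=
  polarization (fun B => withSlice (F B) (τ B)) i j + hessianAt (fun B => Real.log |(τ B * W B).det|) i j

/-- [folklore] Unfolding lemma. -/
theorem orbitPol_def (F : Family ι n m) (τ : (ι → ℝ) → Matrix (Fin r) (Fin n) ℝ) (W : (ι → ℝ) → Matrix (Fin n) (Fin r) ℝ)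
    (i j : ι) :
    orbitPol F τ W i j
      = polarization (fun B => withSlice (F B) (τ B)) i j + hessianAt (fun B => Real.log |(τ B * W B).det|) i j := rfl

/-- [folklore] **(R29-1) AT MODEL LEVEL (log-Z sign): the sliced polarization is the orbit polarization MINUS the slice's ghost term.** -/
theorem polarization_eq_orbitPol_sub (F : Family ι n m) (τ : (ι → ℝ) → Matrix (Fin r) (Fin n) ℝ)
    (W : (ι → ℝ) → Matrix (Fin n) (Fin r) ℝ) (i j : ι) :
    polarization (fun B => withSlice (F B) (τ B)) i j
      = orbitPol F τ W i j - hessianAt (fun B => Real.log |(τ B * W B).det|) i j := by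
  rw [orbitPol_def]; ring

/-- [folklore] **SLICE-INDEPENDENCE OF THE ORBIT POLARIZATION** (= `GaugeFixing` II′ rearranged): under (c1) `Δ·W = 0`,
`Δᵀ·W = 0`, (c2) `Q·W = 0`, admissibility of both slices and nondegeneracy of the τ-sliced system EVENTUALLY near `0`, and `C²`
at `0` of the `P`-sliced `log Z` and of both Faddeev–Popov logarithms, the orbit polarizations read in `τ` and in `P` COINCIDE. -/
theorem orbitPol_eq_of_slices (F : Family ι n m) (τ P : (ι → ℝ) → Matrix (Fin r) (Fin n) ℝ)
    (W : (ι → ℝ) → Matrix (Fin n) (Fin r) ℝ)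
    (h : ∀ᶠ B in nhds 0, (F B).Δ * W B = 0 ∧ (F B).Δᵀ * W B = 0 ∧ (F B).Q * W B = 0 ∧ IsUnit (τ B * W B).det ∧
      IsUnit (P B * W B).det ∧ (withSlice (F B) (τ B)).kkt.det ≠ 0)
    (hP : ContDiffAt ℝ 2 (Family.logZ fun B => withSlice (F B) (P B)) 0)
    (hτW : ContDiffAt ℝ 2 (fun B => Real.log |(τ B * W B).det|) 0)
    (hPW : ContDiffAt ℝ 2 (fun B => Real.log |(P B * W B).det|) 0) (i j : ι) :
    orbitPol F τ W i j = orbitPol F P W i j := by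
  rw [orbitPol_def, orbitPol_def, polarization_withSlice_eq_sub_add F τ P W h hP hτW hPW i j]
  ring

variable {X κ : Type*} [Fintype X] [DecidableEq X] [Fintype κ] [DecidableEq κ]

/-- [folklore] **ON A FOREST (UNIPOTENT) SLICE THE ORBIT POLARIZATION IS THE PLAIN POLARIZATION**: if `P B · W B` is (a
reindexing of) a forest matrix with unimodular child-end blocks for every `B` (`TreeSliceUnipotent`), the Faddeev–Popov term is `0`. -/
theorem orbitPol_eq_polarization_of_forest (F : Family ι n m) (P : (ι → ℝ) → Matrix (Fin r) (Fin n) ℝ)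
    (W : (ι → ℝ) → Matrix (Fin n) (Fin r) ℝ) (e : X × κ ≃ Fin r) (parent : X → Option X) (rk : X → ℕ)
    (hrk : ∀ x y, parent x = some y → rk y < rk x) (C A : (ι → ℝ) → X → Matrix κ κ ℝ) (hA : ∀ B x, |(A B x).det| = 1)
    (hPW : ∀ B, P B * W B = Matrix.reindex e e (forestMatrix parent (C B) (A B))) (i j : ι) :
    orbitPol F P W i j = polarization (fun B => withSlice (F B) (P B)) i j := by
  rw [orbitPol_def, hessianAt_log_abs_det_eq_zero_of_forest P W e parent rk hrk C A hA hPW i j, add_zero]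

/-- [folklore] **HENCE A GENERAL SLICE READS THE FOREST POLARIZATION MINUS ITS OWN GHOST TERM**: for a τ-sliced family satisfying
II′'s hypotheses against a forest slice `P`, `polarization (withSlice F τ) = polarization (withSlice F P) − hessianAt log|det τW|`
— the MODEL form of «typed weak-Landau kernel = tree-gauge (orbit) kernel − ghost loop» (RULING (R29-1), log-Z sign). -/
theorem polarization_eq_forest_sub_ghost (F : Family ι n m) (τ P : (ι → ℝ) → Matrix (Fin r) (Fin n) ℝ)
    (W : (ι → ℝ) → Matrix (Fin n) (Fin r) ℝ) (e : X × κ ≃ Fin r) (parent : X → Option X) (rk : X → ℕ)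
    (hrk : ∀ x y, parent x = some y → rk y < rk x) (C A : (ι → ℝ) → X → Matrix κ κ ℝ) (hA : ∀ B x, |(A B x).det| = 1)
    (hPW : ∀ B, P B * W B = Matrix.reindex e e (forestMatrix parent (C B) (A B)))
    (h : ∀ᶠ B in nhds 0, (F B).Δ * W B = 0 ∧ (F B).Δᵀ * W B = 0 ∧ (F B).Q * W B = 0 ∧ IsUnit (τ B * W B).det ∧
      (withSlice (F B) (τ B)).kkt.det ≠ 0)
    (hP : ContDiffAt ℝ 2 (Family.logZ fun B => withSlice (F B) (P B)) 0)
    (hτW : ContDiffAt ℝ 2 (fun B => Real.log |(τ B * W B).det|) 0) (i j : ι) :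
    polarization (fun B => withSlice (F B) (τ B)) i j
      = polarization (fun B => withSlice (F B) (P B)) i j - hessianAt (fun B => Real.log |(τ B * W B).det|) i j := by
  have h' : ∀ᶠ B in nhds 0, (F B).Δ * W B = 0 ∧ (F B).Δᵀ * W B = 0 ∧ (F B).Q * W B = 0 ∧ IsUnit (τ B * W B).det ∧
      IsUnit (P B * W B).det ∧ (withSlice (F B) (τ B)).kkt.det ≠ 0 := by
    filter_upwards [h] with B hB
    exact ⟨hB.1, hB.2.1, hB.2.2.1, hB.2.2.2.1, isUnit_det_of_forest P W e parent rk hrk C A hA hPW B, hB.2.2.2.2⟩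
  rw [polarization_eq_orbitPol_sub F τ W, orbitPol_eq_of_slices F τ P W h' hP hτW
    (contDiffAt_log_abs_det_of_forest P W e parent rk hrk C A hA hPW) i j,
    orbitPol_eq_polarization_of_forest F P W e parent rk hrk C A hA hPW i j]

end Literature.MathematicalPhysics.QuantumFieldTheory.Balaban1983to89.Beta.OrbitPolarization

/-! ## v1.1 — TREE-INDEPENDENCE AT MODEL LEVEL (CHECK ITEM (D-h′) of IDENT-122-CHECKLIST v0.5): two forest slices give the SAME
polarization -/

namespace Literature.MathematicalPhysics.QuantumFieldTheory.Balaban1983to89.Beta.OrbitPolarization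

open Matrix
open Literature.MathematicalPhysics.QuantumFieldTheory.Balaban1983to89.Beta
open Literature.MathematicalPhysics.QuantumFieldTheory.Balaban1983to89.Beta.GaugeFixing
open Literature.MathematicalPhysics.QuantumFieldTheory.Balaban1983to89.Beta.TreeSliceUnipotent

variable {ι : Type*} [Fintype ι] [DecidableEq ι] {n m r : ℕ}
variable {X κ X' κ' : Type*} [Fintype X] [DecidableEq X] [Fintype κ] [DecidableEq κ]
  [Fintype X'] [DecidableEq X'] [Fintype κ'] [DecidableEq κ']

/-- [folklore] **TREE-INDEPENDENCE (model level).**  Two FOREST slices `P`, `P′` of the same family with the same orbit directions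
`W` (each `P·W`, `P′·W` a reindexed forest matrix with unimodular child-end blocks, for every `B`) have EQUAL polarizations, given
(c1)/(c2), nondegeneracy of the `P`-sliced system eventually near `0` and `C²` at `0` of the `P′`-sliced `log Z` — both orbit
polarizations equal their plain polarizations and the orbit polarization is slice-independent.  This is the identity behind the
dressed family's lattice symmetry on route (α): a block tree and its reflected tree are two forest slices. -/
theorem polarization_eq_of_forests (F : Family ι n m) (P P' : (ι → ℝ) → Matrix (Fin r) (Fin n) ℝ)
    (W : (ι → ℝ) → Matrix (Fin n) (Fin r) ℝ)
    (e : X × κ ≃ Fin r) (parent : X → Option X) (rk : X → ℕ) (hrk : ∀ x y, parent x = some y → rk y < rk x)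
    (C A : (ι → ℝ) → X → Matrix κ κ ℝ) (hA : ∀ B x, |(A B x).det| = 1)
    (hPW : ∀ B, P B * W B = Matrix.reindex e e (forestMatrix parent (C B) (A B)))
    (e' : X' × κ' ≃ Fin r) (parent' : X' → Option X') (rk' : X' → ℕ) (hrk' : ∀ x y, parent' x = some y → rk' y < rk' x)
    (C' A' : (ι → ℝ) → X' → Matrix κ' κ' ℝ) (hA' : ∀ B x, |(A' B x).det| = 1)
    (hPW' : ∀ B, P' B * W B = Matrix.reindex e' e' (forestMatrix parent' (C' B) (A' B)))
    (h : ∀ᶠ B in nhds 0, (F B).Δ * W B = 0 ∧ (F B).Δᵀ * W B = 0 ∧ (F B).Q * W B = 0 ∧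
      (withSlice (F B) (P B)).kkt.det ≠ 0)
    (hP' : ContDiffAt ℝ 2 (Family.logZ fun B => withSlice (F B) (P' B)) 0) (i j : ι) :
    polarization (fun B => withSlice (F B) (P B)) i j = polarization (fun B => withSlice (F B) (P' B)) i j := by
  have h' : ∀ᶠ B in nhds 0, (F B).Δ * W B = 0 ∧ (F B).Δᵀ * W B = 0 ∧ (F B).Q * W B = 0 ∧ IsUnit (P B * W B).det ∧
      IsUnit (P' B * W B).det ∧ (withSlice (F B) (P B)).kkt.det ≠ 0 := by
    filter_upwards [h] with B hB
    exact ⟨hB.1, hB.2.1, hB.2.2.1, isUnit_det_of_forest P W e parent rk hrk C A hA hPW B,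
      isUnit_det_of_forest P' W e' parent' rk' hrk' C' A' hA' hPW' B, hB.2.2.2⟩
  rw [← orbitPol_eq_polarization_of_forest F P W e parent rk hrk C A hA hPW i j,
    ← orbitPol_eq_polarization_of_forest F P' W e' parent' rk' hrk' C' A' hA' hPW' i j]
  exact orbitPol_eq_of_slices F P P' W h' hP'
    (contDiffAt_log_abs_det_of_forest P W e parent rk hrk C A hA hPW)
    (contDiffAt_log_abs_det_of_forest P' W e' parent' rk' hrk' C' A' hA' hPW') i j

end Literature.MathematicalPhysics.QuantumFieldTheory.Balaban1983to89.Beta.OrbitPolarization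

end
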